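import Literature.NumberTheory.LFunctions.FordIncompleteSetup
import Literature.NumberTheory.LFunctions.FordIncompleteS3Comb
import HarnessLib

/-!
# Ford's Lemma 4.1, case `S₃`: the analytic chain

Topic `Literature/NumberTheory/LFunctions`. Everything here is PROVED.

K. Ford, Proc. LMS 85 (2002), proof of Lemma 4.1, case `S₃`: solutions of (4.1) in which some
variable `x_i` (`i > t`) is *special* with respect to the head `x = (x_1,…,x_t)`, i.e.
`x_i = d·w'` with `d ≤ P^{1/h}` and every prime factor of `w'` dividing `J(x)`. Writing
`𝒢(α) = ∑_g G_g(α) D_g(α)` (grouping by `g = rad w'`), two Cauchy–Schwarz steps, the crude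
bounds of `FordIncompleteS3Comb` and the interpolation `J_{s-1} ≤ J_t^{1/(s-t)} J_s^{1-1/(s-t)}`
give the bound packaged in `FordVK.S3_core_sq_le`.

## References

* K. Ford, Proc. London Math. Soc. (3) 85 (2002), 565–633, proof of Lemma 4.1 (case S₃,
  (4.5)–(4.6)). [Ford2002]
-/

noncomputable section

open Finset MeasureTheory Complex
open scoped Real ComplexConjugate

namespace Literature.NumberTheory.LFunctions
namespace FordVK

open VMV FordSmooth

/-! ### The Jacobian-type product `J*(x)` and special variables -/

/-- `J*(x) = x_1⋯x_t ∏_{i<j} (x_j − x_i)` (Ford's `J*`; up to the factor `k!/(h-1)!` and the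
exponent `h-1` on the first product this is the Jacobian (4.2)). [cite: Ford2002, (4.2) and the
definition of `J*` in the proof of Lemma 4.1] -/
def Jstar {t : ℕ} (x : Fin t → ℤ) : ℤ := (∏ i, x i) * ∏ i, ∏ j ∈ Ioi i, (x j - x i)

/-- `|J*(x)|` as a natural number. [folklore] -/
def JN {t : ℕ} (x : Fin t → ℤ) : ℕ := (Jstar x).natAbs

/-- `J*(x) ≠ 0` for injective `x` with nonzero coordinates. [folklore] -/
theorem Jstar_ne_zero {t : ℕ} {x : Fin t → ℤ} (hx : Function.Injective x) (hx0 : ∀ i, x i ≠ 0) :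
    Jstar x ≠ 0 := by
  unfold Jstar
  refine mul_ne_zero (prod_ne_zero_iff.2 fun i _ => hx0 i) (prod_ne_zero_iff.2 fun i _ =>
    prod_ne_zero_iff.2 fun j hj => ?_)
  rw [mem_Ioi] at hj
  exact sub_ne_zero.2 fun h => (ne_of_gt hj) (hx h)

/-- `∑_{i<t} #{j > i} = t(t-1)/2` (in the form `2·∑ = t(t-1)`). [folklore] -/
theorem two_mul_sum_card_Ioi (t : ℕ) : 2 * ∑ i : Fin t, (Ioi i).card = t * (t - 1) := by
  have h1 : ∑ i : Fin t, (Ioi i).card = ∑ i ∈ range t, (t - 1 - i) := by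
    rw [← Fin.sum_univ_eq_sum_range (fun i => t - 1 - i) t]
    exact sum_congr rfl fun i _ => by rw [Fin.card_Ioi]
  rw [h1, sum_range_reflect (fun i => i) t, mul_comm, sum_range_id_mul_two]

/-- `|J*(x)| ≤ P^{t(t+1)/2}` when `1 ≤ x_i ≤ P`. [cite: Ford2002, proof of Lemma 4.1
("|J*(x)| < P^{t(t+1)/2}")] -/
theorem JN_le {t : ℕ} {P : ℝ} (hP : 1 ≤ P) {x : Fin t → ℤ} (hx : ∀ i, 1 ≤ x i ∧ (x i : ℝ) ≤ P) :
    (JN x : ℝ) ≤ P ^ ((t : ℝ) * (t + 1) / 2) := by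
  have hP0 : 0 ≤ P := by linarith
  have hxi : ∀ i, (1 : ℝ) ≤ x i := fun i => by exact_mod_cast (hx i).1
  have habs : ∀ i, |(x i : ℝ)| ≤ P := fun i => by
    rw [abs_of_pos (by linarith [hxi i])]; exact (hx i).2
  have hdiff : ∀ i j, |(x j : ℝ) - x i| ≤ P := fun i j => by
    have h1 := hxi i; have h2 := hxi j; have h3 := (hx i).2; have h4 := (hx j).2
    rw [abs_le]; constructor <;> linarith
  have hcast : (JN x : ℝ) = |(Jstar x : ℝ)| := by
    rw [JN, Nat.cast_natAbs, Int.cast_abs]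
  rw [hcast, Jstar]
  push_cast
  rw [abs_mul, Finset.abs_prod, Finset.abs_prod]
  simp_rw [Finset.abs_prod]
  have hA : ∏ i, |(x i : ℝ)| ≤ P ^ t := by
    calc ∏ i, |(x i : ℝ)| ≤ ∏ _i : Fin t, P := Finset.prod_le_prod (fun i _ => abs_nonneg _) fun i _ => habs i
      _ = P ^ t := by simp
  have hB : ∏ i : Fin t, ∏ j ∈ Ioi i, |(x j : ℝ) - x i| ≤ P ^ (∑ i : Fin t, (Ioi i).card) := by
    rw [← Finset.prod_pow_eq_pow_sum]
    refine Finset.prod_le_prod (fun i _ => Finset.prod_nonneg fun j _ => abs_nonneg _) fun i _ => ?_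
    calc ∏ j ∈ Ioi i, |(x j : ℝ) - x i| ≤ ∏ _j ∈ Ioi i, P :=
          Finset.prod_le_prod (fun j _ => abs_nonneg _) fun j _ => hdiff i j
      _ = P ^ (Ioi i).card := by simp
  have hN : ((t + ∑ i : Fin t, (Ioi i).card : ℕ) : ℝ) = (t : ℝ) * (t + 1) / 2 := by
    have h2 := two_mul_sum_card_Ioi t
    have : ((2 * ∑ i : Fin t, (Ioi i).card : ℕ) : ℝ) = ((t * (t - 1) : ℕ) : ℝ) := by rw [h2]
    push_cast at this
    rcases Nat.eq_zero_or_pos t with h0 | hpos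
    · subst h0; simp
    · rw [Nat.cast_sub hpos] at this; push_cast at this ⊢; nlinarith
  calc (∏ i, |(x i : ℝ)|) * ∏ i : Fin t, ∏ j ∈ Ioi i, |(x j : ℝ) - x i|
      ≤ P ^ t * P ^ (∑ i : Fin t, (Ioi i).card) :=
        mul_le_mul hA hB (Finset.prod_nonneg fun i _ => Finset.prod_nonneg fun j _ => abs_nonneg _)
          (pow_nonneg hP0 _)
    _ = P ^ ((t + ∑ i : Fin t, (Ioi i).card : ℕ) : ℝ) := by rw [← pow_add, Real.rpow_natCast]
    _ = P ^ ((t : ℝ) * (t + 1) / 2) := by rw [hN]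

/-- The predicate "`w` is special with respect to `J`": `w = d·w'` with `d ≤ Q` and `rad w' ∣ J`
(Ford's `w 𝒟(Q) J`). [cite: Ford2002, §4 (the relation `x 𝒟(Q) y`)] -/
def Special (Qn J w : ℕ) : Prop := ∃ d ∈ w.divisors, d ≤ Qn ∧ rad (w / d) ∣ J

/-- `Special` is decidable (bounded quantifier over the divisors). [folklore] -/
instance (Qn J w : ℕ) : Decidable (Special Qn J w) := by unfold Special; infer_instance

/-! ### The index sets of the `S₃` chain -/

section Sets

variable (k h g t : ℕ) (B : Finset ℤ) (C D : Finset ℕ) (Pn : ℕ)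

/-- Injective heads. [folklore] -/
def tuplesInj : Finset (Fin t → ℤ) := (tuples t B).filter fun x => Function.Injective x

/-- The index set of the sum `𝒢(α)`: triples `(x, d, w')` with `x` an injective head, `d ∈ 𝒞(Q,R)`,
`w' ∈ 𝒞(P,R)`, `d w' ≤ P`, `rad w' ∣ J*(x)`. [cite: Ford2002, proof of Lemma 4.1 (the sum `𝒢(α)`)] -/
def XDW : Finset ((Fin t → ℤ) × (ℕ × ℕ)) :=
  (tuplesInj t B ×ˢ (D ×ˢ C)).filter fun p => p.2.1 * p.2.2 ≤ Pn ∧ rad p.2.2 ∣ JN p.1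

/-- The frequencies of `𝒢`: `s(x) + ν(d w')`. [folklore] -/
def vXDW (p : (Fin t → ℤ) × (ℕ × ℕ)) : Fin k → ℤ :=
  psvR k h g p.1 + nuR k h g ((p.2.1 * p.2.2 : ℕ) : ℤ)

/-- The possible values of `g = rad w'`. [folklore] -/
def Gset : Finset ℕ := C.image rad

/-- Heads with `g ∣ J*(x)` (index set of `G_g`). [cite: Ford2002, proof of Lemma 4.1 (`G_g(α)`)] -/
def Xg (g' : ℕ) : Finset (Fin t → ℤ) := (tuplesInj t B).filter fun x => g' ∣ JN x

/-- Pairs `(d, w')` with `d w' ≤ P` and `rad w' = g` (index set of `D_g`). [cite: Ford2002, proof of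
Lemma 4.1 (the inner double sum of `𝒢`)] -/
def DWg (g' : ℕ) : Finset (ℕ × ℕ) := (D ×ˢ C).filter fun q => q.1 * q.2 ≤ Pn ∧ rad q.2 = g'

/-- All pairs `(d, w')` with `d w' ≤ P`. [folklore] -/
def DW : Finset (ℕ × ℕ) := (D ×ˢ C).filter fun q => q.1 * q.2 ≤ Pn

end Sets

variable {k h g t : ℕ} {B : Finset ℤ} {C D : Finset ℕ} {Pn : ℕ}

/-- The fibre of `XDW` over `g` is `X_g × DW_g`. [folklore] -/
theorem XDW_filter_eq (g' : ℕ) :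
    (XDW t B C D Pn).filter (fun p => rad p.2.2 = g') = Xg t B g' ×ˢ DWg C D Pn g' := by
  ext p
  simp only [XDW, Xg, DWg, mem_filter, mem_product]
  constructor
  · rintro ⟨⟨⟨hx, hd, hw⟩, hle, hdvd⟩, hrad⟩
    exact ⟨⟨hx, hrad ▸ hdvd⟩, ⟨hd, hw⟩, hle, hrad⟩
  · rintro ⟨⟨hx, hdvd⟩, ⟨hd, hw⟩, hle, hrad⟩
    exact ⟨⟨⟨hx, hd, hw⟩, hle, hrad.symm ▸ hdvd⟩, hrad⟩

/-- **`𝒢(α) = ∑_g G_g(α) D_g(α)`.** [cite: Ford2002, proof of Lemma 4.1 (definition of `𝒢`)] -/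
theorem tp_XDW_eq_sum (α : Fin k → ℝ) :
    tp (XDW t B C D Pn) (vXDW k h g t) α = ∑ g' ∈ Gset C,
      tp (Xg t B g') (psvR k h g) α * tp (DWg C D Pn g') (fun q => nuR k h g ((q.1 * q.2 : ℕ) : ℤ)) α := by
  classical
  unfold tp
  rw [← Finset.sum_fiberwise_of_maps_to (s := XDW t B C D Pn) (t := Gset C) (g := fun p => rad p.2.2)
    (fun p hp => by
      rw [XDW, mem_filter, mem_product, mem_product] at hp
      exact mem_image_of_mem _ hp.1.2.2)]
  refine sum_congr rfl fun g' _ => ?_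
  rw [XDW_filter_eq, ← tp, ← tp, ← tp, tp_mul]
  rfl

/-! ### The crude bound for `∑_g |D_g(α)|²` -/

/-- `|D_g(α)| ≤ #DW_g`. [folklore] -/
theorem norm_tp_DWg_le (g' : ℕ) (α : Fin k → ℝ) :
    ‖tp (DWg C D Pn g') (fun q => nuR k h g ((q.1 * q.2 : ℕ) : ℤ)) α‖ ≤ (DWg C D Pn g').card :=
  norm_tp_le _ _ _

/-- `#DW_g ≤ #D · #{w ∈ C : rad w = g}`. [folklore] -/
theorem card_DWg_le (g' : ℕ) :
    (DWg C D Pn g').card ≤ D.card * (C.filter fun w => rad w = g').card := by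
  rw [← card_product]
  refine card_le_card fun q hq => ?_
  rw [DWg, mem_filter, mem_product] at hq
  rw [mem_product, mem_filter]
  exact ⟨hq.1.1, hq.1.2, hq.2.2⟩

/-- `∑_{g ∈ Gset} #DW_g = #DW`. [folklore] -/
theorem sum_card_DWg_eq : ∑ g' ∈ Gset C, (DWg C D Pn g').card = (DW C D Pn).card := by
  rw [card_eq_sum_card_fiberwise (s := DW C D Pn) (t := Gset C) (f := fun q => rad q.2)
    (fun q hq => by
      rw [mem_coe, DW, mem_filter, mem_product] at hq
      exact mem_coe.2 (mem_image_of_mem _ hq.1.2))]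
  refine sum_congr rfl fun g' _ => ?_
  congr 1
  ext q
  simp only [DWg, DW, mem_filter, mem_product, and_assoc]

/-- **`#DW ≤ ∑_{n ∈ C} τ(n)`** when `C = 𝒞(P,R)` is closed under the products in question:
the map `(d, w') ↦ (d w', d)`. [cite: Ford2002, proof of Lemma 4.1 ("≤ P^{1/r} … ∑_{n ∈ 𝒞} d₂(n)")] -/
theorem card_DW_le (hmul : ∀ q ∈ DW C D Pn, q.1 * q.2 ∈ C) (hD0 : ∀ d ∈ D, d ≠ 0)
    (hC0 : ∀ w ∈ C, w ≠ 0) :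
    (DW C D Pn).card ≤ ∑ n ∈ C, n.divisors.card := by
  rw [← card_sigma]
  refine card_le_card_of_injOn (fun q => ⟨q.1 * q.2, q.1⟩) (fun q hq => ?_) ?_
  · rw [mem_coe, mem_sigma]
    have hq' := hq
    rw [mem_coe, DW, mem_filter, mem_product] at hq'
    refine ⟨hmul q hq, ?_⟩
    rw [Nat.mem_divisors]
    exact ⟨dvd_mul_right _ _, mul_ne_zero (hD0 _ hq'.1.1) (hC0 _ hq'.1.2)⟩
  · intro q₁ hq₁ q₂ hq₂ h12
    simp only [Sigma.mk.injEq] at h12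
    obtain ⟨hprod, hd⟩ := h12
    have hd' : q₁.1 = q₂.1 := eq_of_heq hd
    have h0 : q₁.1 ≠ 0 := by
      rw [mem_coe, DW, mem_filter, mem_product] at hq₁
      exact hD0 _ hq₁.1.1
    refine Prod.ext hd' ?_
    rw [hd'] at hprod h0
    exact Nat.eq_of_mul_eq_mul_left (Nat.pos_of_ne_zero h0) hprod


/-- Products of compatible smooth numbers are smooth: `d ∈ 𝒞(Q,R)`, `w ∈ 𝒞(P,R)`, `dw ≤ ⌊P⌋`
give `dw ∈ 𝒞(P,R)`. [folklore] -/
theorem mul_mem_smoothSet {P Q R : ℝ} (hP : 0 ≤ P) {d w : ℕ} (hd : d ∈ smoothSet Q R)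
    (hw : w ∈ smoothSet P R) (hle : d * w ≤ ⌊P⌋₊) : d * w ∈ smoothSet P R := by
  rw [mem_smoothSet] at hd hw ⊢
  refine ⟨one_le_mul hd.1 hw.1, ?_, fun p hp => ?_⟩
  · exact le_trans (by exact_mod_cast hle) (Nat.floor_le hP)
  · rw [Nat.primeFactors_mul (by omega) (by omega), mem_union] at hp
    rcases hp with hp | hp
    · exact hd.2.2 p hp
    · exact hw.2.2 p hp

/-- **`∑_g (#DW_g)² ≤ Q·2^{⌊2/η⌋}·|𝒞|·2^{⌊2/η⌋}`** (Ford: `2^{6/η} P^{1/r} |𝒞|`).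
[cite: Ford2002, proof of Lemma 4.1 (the display bounding `∑_g |∑_{d,w} 1|²`)] -/
theorem sum_card_DWg_sq_le {P R Q η : ℝ} (hP : 1 ≤ P) (hη : 0 < η) (hR : R = P ^ η) (hQ : 0 ≤ Q) :
    ∑ g' ∈ Gset (smoothSet P R), (((DWg (smoothSet P R) (smoothSet Q R) ⌊P⌋₊ g').card : ℝ)) ^ 2
      ≤ Q * 2 ^ ⌊2 / η⌋₊ * ((smoothSet P R).card * 2 ^ ⌊2 / η⌋₊) := by
  set C := smoothSet P R with hC
  set D := smoothSet Q R with hD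
  set N₀ := ⌊2 / η⌋₊ with hN₀
  have hP0 : 0 ≤ P := by linarith
  -- each square `≤ (#DW_g) · (Q 2^{N₀})`
  have h1 : ∀ g', (((DWg C D ⌊P⌋₊ g').card : ℝ)) ^ 2 ≤ ((DWg C D ⌊P⌋₊ g').card : ℝ) * (Q * 2 ^ N₀) := by
    intro g'
    rw [sq]
    refine mul_le_mul_of_nonneg_left ?_ (Nat.cast_nonneg _)
    have h2 := card_DWg_le (C := C) (D := D) (Pn := ⌊P⌋₊) g'
    have h3 := card_rad_fiber_le hP hη hR g'
    have h4 := card_smoothSet_le_self (R := R) hQ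
    rw [← hC] at h3; rw [← hD] at h4
    calc ((DWg C D ⌊P⌋₊ g').card : ℝ) ≤ ((D.card * (C.filter fun w => rad w = g').card : ℕ) : ℝ) := by
          exact_mod_cast h2
      _ ≤ Q * 2 ^ N₀ := by
          push_cast
          exact mul_le_mul h4 (by exact_mod_cast h3) (Nat.cast_nonneg _) hQ
  -- sum of `#DW_g` is `#DW ≤ |C| 2^{N₀}`
  have hDW : ((DW C D ⌊P⌋₊).card : ℝ) ≤ (C.card : ℝ) * 2 ^ N₀ := by
    have h5 := card_DW_le (C := C) (D := D) (Pn := ⌊P⌋₊)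
      (fun q hq => by
        rw [DW, mem_filter, mem_product] at hq
        exact mul_mem_smoothSet hP0 hq.1.1 hq.1.2 hq.2)
      (fun d hd => by have := (mem_smoothSet.1 hd).1; omega)
      (fun w hw => by have := (mem_smoothSet.1 hw).1; omega)
    have h6 : ∑ n ∈ C, n.divisors.card ≤ ∑ _n ∈ C, 2 ^ N₀ := by
      refine sum_le_sum fun n hn => ?_
      have hn0 : n ≠ 0 := by have := (mem_smoothSet.1 hn).1; omega
      exact (card_divisors_le_two_pow_cardFactors hn0).trans
        (Nat.pow_le_pow_right (by norm_num) (cardFactors_le_of_mem_smoothSet hP hη hR hn))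
    rw [sum_const, smul_eq_mul] at h6
    exact_mod_cast h5.trans h6
  calc ∑ g' ∈ Gset C, (((DWg C D ⌊P⌋₊ g').card : ℝ)) ^ 2
      ≤ ∑ g' ∈ Gset C, ((DWg C D ⌊P⌋₊ g').card : ℝ) * (Q * 2 ^ N₀) := sum_le_sum fun g' _ => h1 g'
    _ = (∑ g' ∈ Gset C, ((DWg C D ⌊P⌋₊ g').card : ℝ)) * (Q * 2 ^ N₀) := by rw [sum_mul]
    _ = ((DW C D ⌊P⌋₊).card : ℝ) * (Q * 2 ^ N₀) := by
        rw [← sum_card_DWg_eq (C := C) (D := D) (Pn := ⌊P⌋₊)]; push_cast; rfl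
    _ ≤ ((C.card : ℝ) * 2 ^ N₀) * (Q * 2 ^ N₀) := mul_le_mul_of_nonneg_right hDW (by positivity)
    _ = Q * 2 ^ N₀ * ((C.card : ℝ) * 2 ^ N₀) := by ring

/-- **Cauchy–Schwarz over `g`**: `|𝒢(α)|² ≤ K_D ∑_g |G_g(α)|²` whenever `∑_g (#DW_g)² ≤ K_D`.
[cite: Ford2002, proof of Lemma 4.1 ("By [Cauchy–Schwarz], |𝒢(α)|² ≤ (∑_g |G_g|²)(∑_g |∑_{d,w} 1|²)")] -/
theorem norm_tp_XDW_sq_le {KD : ℝ} (hKD : ∑ g' ∈ Gset C, (((DWg C D Pn g').card : ℝ)) ^ 2 ≤ KD)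
    (α : Fin k → ℝ) :
    ‖tp (XDW t B C D Pn) (vXDW k h g t) α‖ ^ 2
      ≤ KD * ∑ g' ∈ Gset C, ‖tp (Xg t B g') (psvR k h g) α‖ ^ 2 := by
  rw [tp_XDW_eq_sum]
  set a : ℕ → ℝ := fun g' => ‖tp (Xg t B g') (psvR k h g) α‖ with ha
  set b : ℕ → ℝ := fun g' => ‖tp (DWg C D Pn g') (fun q => nuR k h g ((q.1 * q.2 : ℕ) : ℤ)) α‖ with hb
  have h1 : ‖∑ g' ∈ Gset C, tp (Xg t B g') (psvR k h g) α *
      tp (DWg C D Pn g') (fun q => nuR k h g ((q.1 * q.2 : ℕ) : ℤ)) α‖ ≤ ∑ g' ∈ Gset C, a g' * b g' := by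
    refine (norm_sum_le _ _).trans (le_of_eq (sum_congr rfl fun g' _ => ?_))
    rw [norm_mul]
  have h2 : (∑ g' ∈ Gset C, a g' * b g') ^ 2 ≤ (∑ g' ∈ Gset C, a g' ^ 2) * ∑ g' ∈ Gset C, b g' ^ 2 :=
    sum_mul_sq_le_sq_mul_sq _ _ _
  have h3 : ∑ g' ∈ Gset C, b g' ^ 2 ≤ KD := by
    refine le_trans (sum_le_sum fun g' _ => ?_) hKD
    exact pow_le_pow_left₀ (norm_nonneg _) (norm_tp_DWg_le (k := k) (h := h) (g := g) g' α) 2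
  have h0 : 0 ≤ ∑ g' ∈ Gset C, a g' * b g' := sum_nonneg fun g' _ => mul_nonneg (norm_nonneg _) (norm_nonneg _)
  calc ‖∑ g' ∈ Gset C, tp (Xg t B g') (psvR k h g) α *
        tp (DWg C D Pn g') (fun q => nuR k h g ((q.1 * q.2 : ℕ) : ℤ)) α‖ ^ 2
      ≤ (∑ g' ∈ Gset C, a g' * b g') ^ 2 := pow_le_pow_left₀ (norm_nonneg _) h1 2
    _ ≤ (∑ g' ∈ Gset C, a g' ^ 2) * ∑ g' ∈ Gset C, b g' ^ 2 := h2
    _ ≤ (∑ g' ∈ Gset C, a g' ^ 2) * KD :=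
        mul_le_mul_of_nonneg_left h3 (sum_nonneg fun g' _ => sq_nonneg _)
    _ = KD * ∑ g' ∈ Gset C, a g' ^ 2 := mul_comm _ _

/-! ### The mean value `V = ∑_g ∫ |G_g|² |f|^{2m'}` -/

/-- `∫ |G_g|² |f|^{2m'}` counts the solutions of `s(x) + s(z) = s(x') + s(z')` with `x, x' ∈ X_g`,
`z, z' ∈ ℬ^{m'}`. [folklore] -/
theorem integral_Gg_sq_eq (m' : ℕ) (g' : ℕ) :
    ∫ α in box k, ‖tp (Xg t B g') (psvR k h g) α‖ ^ 2 * ‖tp B (nuR k h g) α‖ ^ (2 * m')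
      = ((((Xg t B g' ×ˢ tuples m' B) ×ˢ (Xg t B g' ×ˢ tuples m' B)).filter fun q =>
          psvR k h g q.1.1 + psvR k h g q.1.2 = psvR k h g q.2.1 + psvR k h g q.2.2).card : ℝ) := by
  have e : ∀ α : Fin k → ℝ, ‖tp (Xg t B g' ×ˢ tuples m' B)
      (fun p => psvR k h g p.1 + psvR k h g p.2) α‖ ^ 2
      = ‖tp (Xg t B g') (psvR k h g) α‖ ^ 2 * ‖tp B (nuR k h g) α‖ ^ (2 * m') := by
    intro α
    rw [show tp (Xg t B g' ×ˢ tuples m' B) (fun p => psvR k h g p.1 + psvR k h g p.2) α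
        = tp (Xg t B g') (psvR k h g) α * tp (tuples m' B) (psvR k h g) α
        from (tp_mul _ _ _ _ α).symm, norm_mul, tp_tuples_psvR, norm_pow, mul_pow, ← pow_mul,
      mul_comm m' 2]
  simp_rw [← e]
  exact integral_norm_sq_tp _ _

/-- **`V ≤ G_max · ∫|f|^{2(t+m')}`**: interchanging the sums over `g` and over the solutions.
[cite: Ford2002, proof of Lemma 4.1 ("Clearly V ≤ J_{s-1,k,h}(𝒞) max_x |{g …}|")] -/
theorem sum_integral_Gg_sq_le (m' : ℕ) {Gmax : ℝ} (hG0 : 0 ≤ Gmax)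
    (hGmax : ∀ x ∈ tuplesInj t B, ((((Gset C).filter fun g' => g' ∣ JN x).card : ℕ) : ℝ) ≤ Gmax) :
    ∑ g' ∈ Gset C, ∫ α in box k, ‖tp (Xg t B g') (psvR k h g) α‖ ^ 2 * ‖tp B (nuR k h g) α‖ ^ (2 * m')
      ≤ Gmax * ∫ α in box k, ‖tp B (nuR k h g) α‖ ^ (2 * (t + m')) := by
  classical
  simp_rw [integral_Gg_sq_eq]
  -- the solutions over all injective heads
  set T := tuples m' B with hT
  set Sol := (((tuplesInj t B ×ˢ T) ×ˢ (tuplesInj t B ×ˢ T))).filter fun q =>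
      psvR k h g q.1.1 + psvR k h g q.1.2 = psvR k h g q.2.1 + psvR k h g q.2.2 with hSol
  have hfib : ∀ g', (((Xg t B g' ×ˢ T) ×ˢ (Xg t B g' ×ˢ T)).filter fun q =>
        psvR k h g q.1.1 + psvR k h g q.1.2 = psvR k h g q.2.1 + psvR k h g q.2.2)
      = Sol.filter fun q => g' ∣ JN q.1.1 ∧ g' ∣ JN q.2.1 := by
    intro g'
    ext q
    simp only [Xg, hSol, mem_filter, mem_product]
    tauto
  simp_rw [hfib]
  have hswap : ∑ g' ∈ Gset C, (((Sol.filter fun q => g' ∣ JN q.1.1 ∧ g' ∣ JN q.2.1).card : ℕ) : ℝ)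
      = ∑ q ∈ Sol, ((((Gset C).filter fun g' => g' ∣ JN q.1.1 ∧ g' ∣ JN q.2.1).card : ℕ) : ℝ) := by
    simp_rw [card_filter]
    push_cast
    rw [sum_comm]
  rw [hswap]
  have hle : ∀ q ∈ Sol, ((((Gset C).filter fun g' => g' ∣ JN q.1.1 ∧ g' ∣ JN q.2.1).card : ℕ) : ℝ) ≤ Gmax := by
    intro q hq
    have hx : q.1.1 ∈ tuplesInj t B := by
      rw [hSol, mem_filter, mem_product, mem_product] at hq; exact hq.1.1.1
    refine le_trans ?_ (hGmax _ hx)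
    exact_mod_cast card_le_card (fun g' hg' => by
      rw [mem_filter] at hg' ⊢; exact ⟨hg'.1, hg'.2.1⟩)
  have hcount : ((Sol.card : ℕ) : ℝ) ≤ ∫ α in box k, ‖tp B (nuR k h g) α‖ ^ (2 * (t + m')) := by
    -- `#Sol ≤ #` solutions over all heads `= ∫ |f^t f^{m'}|²`
    have h1 : Sol.card ≤ ((((tuples t B ×ˢ T) ×ˢ (tuples t B ×ˢ T))).filter fun q =>
        psvR k h g q.1.1 + psvR k h g q.1.2 = psvR k h g q.2.1 + psvR k h g q.2.2).card := by
      refine card_le_card fun q hq => ?_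
      simp only [hSol, tuplesInj, mem_filter, mem_product] at hq
      simp only [mem_filter, mem_product]
      exact ⟨⟨⟨hq.1.1.1.1, hq.1.1.2⟩, hq.1.2.1.1, hq.1.2.2⟩, hq.2⟩
    have h2 := integral_norm_sq_tp (n := k) (tuples t B ×ˢ T) (fun p => psvR k h g p.1 + psvR k h g p.2)
    calc ((Sol.card : ℕ) : ℝ) ≤ (((((tuples t B ×ˢ T) ×ˢ (tuples t B ×ˢ T))).filter fun q =>
          psvR k h g q.1.1 + psvR k h g q.1.2 = psvR k h g q.2.1 + psvR k h g q.2.2).card : ℝ) := by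
          exact_mod_cast h1
      _ = ∫ α in box k, ‖tp (tuples t B ×ˢ T) (fun p => psvR k h g p.1 + psvR k h g p.2) α‖ ^ 2 :=
          h2.symm
      _ = ∫ α in box k, ‖tp B (nuR k h g) α‖ ^ (2 * (t + m')) := by
          refine integral_congr_ae (ae_of_all _ fun α => ?_)
          simp only
          rw [show tp (tuples t B ×ˢ T) (fun p => psvR k h g p.1 + psvR k h g p.2) α
              = tp (tuples t B) (psvR k h g) α * tp T (psvR k h g) α from (tp_mul _ _ _ _ α).symm,
            hT, tp_tuples_psvR, tp_tuples_psvR, norm_mul, norm_pow, norm_pow, ← pow_add, ← pow_mul]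
          ring_nf
  calc ∑ q ∈ Sol, ((((Gset C).filter fun g' => g' ∣ JN q.1.1 ∧ g' ∣ JN q.2.1).card : ℕ) : ℝ)
      ≤ ∑ _q ∈ Sol, Gmax := sum_le_sum hle
    _ = Sol.card * Gmax := by rw [sum_const, nsmul_eq_mul]
    _ ≤ (∫ α in box k, ‖tp B (nuR k h g) α‖ ^ (2 * (t + m'))) * Gmax :=
        mul_le_mul_of_nonneg_right hcount hG0
    _ = Gmax * ∫ α in box k, ‖tp B (nuR k h g) α‖ ^ (2 * (t + m')) := mul_comm _ _


/-! ### The `S₃` chain -/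

/-- The interpolation step `∫|f|^{2(t+m')} ≤ J_t^{1/(m'+1)} J_s^{1-1/(m'+1)}`, `s = t + m' + 1`.
[cite: Ford2002, proof of Lemma 4.1 ("J_{s-1,k,h} ≤ J_{s,k,h}^{1-1/(s-t)} J_{t,k,h}^{1/(s-t)}")] -/
theorem integral_norm_pow_interpolate (m' : ℕ) :
    ∫ α in box k, ‖tp B (nuR k h g) α‖ ^ (2 * (t + m'))
      ≤ (Jinc k t B h g : ℝ) ^ (1 / ((m' : ℝ) + 1))
        * (Jinc k (t + (m' + 1)) B h g : ℝ) ^ (1 - 1 / ((m' : ℝ) + 1)) := by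
  rcases Nat.eq_zero_or_pos m' with h0 | hpos
  · subst h0
    simp only [Nat.cast_zero, zero_add, div_one, sub_self, Real.rpow_zero, mul_one, Real.rpow_one,
      add_zero]
    rw [integral_norm_tp_nuR_pow]
  have hθ0 : 0 < 1 / ((m' : ℝ) + 1) := by positivity
  have hθ1 : 1 / ((m' : ℝ) + 1) < 1 := by
    rw [div_lt_one (by positivity)]
    have : (1 : ℝ) ≤ m' := by exact_mod_cast hpos
    linarith
  have hI := integral_rpow_interpolate_le (F := fun α => ‖tp B (nuR k h g) α‖) (continuous_tp _ _).norm
    (fun α => norm_nonneg _) (a := 2 * (t : ℝ)) (b := 2 * ((t : ℝ) + (m' + 1))) (by positivity)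
    (by positivity) hθ0 hθ1
  have he : 1 / ((m' : ℝ) + 1) * (2 * (t : ℝ)) + (1 - 1 / ((m' : ℝ) + 1)) * (2 * ((t : ℝ) + (m' + 1)))
      = ((2 * (t + m') : ℕ) : ℝ) := by
    field_simp
    push_cast
    ring
  rw [he] at hI
  have ha : ∀ α, ‖tp B (nuR k h g) α‖ ^ (2 * (t : ℝ)) = ‖tp B (nuR k h g) α‖ ^ (2 * t) := fun α => by
    rw [show (2 * (t : ℝ)) = ((2 * t : ℕ) : ℝ) by push_cast; ring, Real.rpow_natCast]
  have hb : ∀ α, ‖tp B (nuR k h g) α‖ ^ (2 * ((t : ℝ) + (m' + 1)))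
      = ‖tp B (nuR k h g) α‖ ^ (2 * (t + (m' + 1))) := fun α => by
    rw [show (2 * ((t : ℝ) + (m' + 1))) = ((2 * (t + (m' + 1)) : ℕ) : ℝ) by push_cast; ring,
      Real.rpow_natCast]
  simp_rw [Real.rpow_natCast, ha, hb, integral_norm_tp_nuR_pow] at hI
  rw [integral_norm_tp_nuR_pow]
  exact hI

/-- The count `N` of the auxiliary system of case `S₃` (Ford's "number of solutions of [the system
after (4.4)]" with the last variable written as `d w'`). [cite: Ford2002, proof of Lemma 4.1 (case S₃)] -/
def S3count (k h g t m' : ℕ) (B : Finset ℤ) (C D : Finset ℕ) (Pn : ℕ) : ℕ :=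
  (((XDW t B C D Pn ×ˢ tuples m' B) ×ˢ (tuples t B ×ˢ tuples (m' + 1) B)).filter fun pq =>
      vXDW k h g t pq.1.1 + psvR k h g pq.1.2 = psvR k h g pq.2.1 + psvR k h g pq.2.2).card

/-- **The core bound of case `S₃`.** With `K_D ≥ ∑_g (#DW_g)²` and `G_max ≥ #{g ∣ J*(x)}` for every
injective head `x`, the number `N` of solutions of
`s(x) + ν(d w') + s(z) = s(y) + s(r')` (`(x,d,w') ∈ XDW`, `z ∈ ℬ^{m'}`, `y ∈ ℬ^t`, `r' ∈ ℬ^{m'+1}`)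
satisfies `N² ≤ K_D G_max J_t^{1/m} J_s^{2-1/m}` (`m = m'+1`, `s = t+m`).
[cite: Ford2002, proof of Lemma 4.1 (case S₃: (4.5), (4.6) and the two displays after)] -/
theorem S3_core_sq_le (m' : ℕ) {KD Gmax : ℝ} (hKD0 : 0 ≤ KD)
    (hKD : ∑ g' ∈ Gset C, (((DWg C D Pn g').card : ℝ)) ^ 2 ≤ KD) (hG0 : 0 ≤ Gmax)
    (hGmax : ∀ x ∈ tuplesInj t B, ((((Gset C).filter fun g' => g' ∣ JN x).card : ℕ) : ℝ) ≤ Gmax) :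
    ((S3count k h g t m' B C D Pn : ℕ) : ℝ) ^ 2
      ≤ KD * Gmax * (Jinc k t B h g : ℝ) ^ (1 / ((m' : ℝ) + 1))
        * (Jinc k (t + (m' + 1)) B h g : ℝ) ^ (2 - 1 / ((m' : ℝ) + 1)) := by
  set f : (Fin k → ℝ) → ℂ := tp B (nuR k h g) with hf
  set GG : (Fin k → ℝ) → ℂ := tp (XDW t B C D Pn) (vXDW k h g t) with hGG
  -- Step 1: count ≤ ∫ (|f|^s) (|𝒢| |f|^{m'})
  have h1 := card_filter_eq_le_integral (n := k) (XDW t B C D Pn ×ˢ tuples m' B)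
    (tuples t B ×ˢ tuples (m' + 1) B) (fun p => vXDW k h g t p.1 + psvR k h g p.2)
    (fun q => psvR k h g q.1 + psvR k h g q.2)
  have hint : ∀ α, ‖tp (XDW t B C D Pn ×ˢ tuples m' B) (fun p => vXDW k h g t p.1 + psvR k h g p.2) α‖
      * ‖tp (tuples t B ×ˢ tuples (m' + 1) B) (fun q => psvR k h g q.1 + psvR k h g q.2) α‖
      = ‖f α‖ ^ (t + (m' + 1)) * (‖GG α‖ * ‖f α‖ ^ m') := by
    intro α
    rw [show tp (XDW t B C D Pn ×ˢ tuples m' B) (fun p => vXDW k h g t p.1 + psvR k h g p.2) α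
        = GG α * tp (tuples m' B) (psvR k h g) α from (tp_mul _ _ _ _ α).symm,
      show tp (tuples t B ×ˢ tuples (m' + 1) B) (fun q => psvR k h g q.1 + psvR k h g q.2) α
        = tp (tuples t B) (psvR k h g) α * tp (tuples (m' + 1) B) (psvR k h g) α
        from (tp_mul _ _ _ _ α).symm,
      tp_tuples_psvR, tp_tuples_psvR, tp_tuples_psvR, norm_mul, norm_mul, norm_pow, norm_pow, norm_pow]
    ring
  simp_rw [hint] at h1
  have h1' : ((S3count k h g t m' B C D Pn : ℕ) : ℝ)
      ≤ ∫ α in box k, ‖f α‖ ^ (t + (m' + 1)) * (‖GG α‖ * ‖f α‖ ^ m') := h1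
  -- Step 2: Cauchy–Schwarz
  have hFc : Continuous fun α => ‖f α‖ ^ (t + (m' + 1)) := ((continuous_tp _ _).norm).pow _
  have hGc : Continuous fun α => ‖GG α‖ * ‖f α‖ ^ m' :=
    (continuous_tp _ _).norm.mul (((continuous_tp _ _).norm).pow _)
  have h2 := integral_mul_le_sqrt hFc hGc (fun α => by positivity) (fun α => by positivity)
  -- Step 3: the two factors
  set S₀ : ℝ := (Jinc k (t + (m' + 1)) B h g : ℝ) with hS₀
  set Jt : ℝ := (Jinc k t B h g : ℝ) with hJt
  have hS₀0 : 0 ≤ S₀ := Nat.cast_nonneg _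
  have hJt0 : 0 ≤ Jt := Nat.cast_nonneg _
  have hA : ∫ α in box k, (‖f α‖ ^ (t + (m' + 1))) ^ 2 = S₀ := by
    simp_rw [← pow_mul, mul_comm (t + (m' + 1)) 2]
    rw [hS₀, hf, integral_norm_tp_nuR_pow]
  have hB : ∫ α in box k, (‖GG α‖ * ‖f α‖ ^ m') ^ 2
      ≤ KD * Gmax * (Jt ^ (1 / ((m' : ℝ) + 1)) * S₀ ^ (1 - 1 / ((m' : ℝ) + 1))) := by
    have hpt : ∀ α, (‖GG α‖ * ‖f α‖ ^ m') ^ 2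
        ≤ KD * ∑ g' ∈ Gset C, ‖tp (Xg t B g') (psvR k h g) α‖ ^ 2 * ‖f α‖ ^ (2 * m') := by
      intro α
      rw [mul_pow, ← pow_mul, mul_comm m' 2, mul_sum]
      have := norm_tp_XDW_sq_le (k := k) (h := h) (g := g) (t := t) (B := B) hKD α
      rw [← hGG] at this
      calc ‖GG α‖ ^ 2 * ‖f α‖ ^ (2 * m')
          ≤ (KD * ∑ g' ∈ Gset C, ‖tp (Xg t B g') (psvR k h g) α‖ ^ 2) * ‖f α‖ ^ (2 * m') :=
            mul_le_mul_of_nonneg_right this (by positivity)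
        _ = ∑ g' ∈ Gset C, KD * (‖tp (Xg t B g') (psvR k h g) α‖ ^ 2 * ‖f α‖ ^ (2 * m')) := by
            rw [mul_sum, sum_mul]; exact sum_congr rfl fun _ _ => by ring
    have hint2 : ∀ g', Integrable (fun α => ‖tp (Xg t B g') (psvR k h g) α‖ ^ 2 * ‖f α‖ ^ (2 * m'))
        (volume.restrict (box k)) := fun g' =>
      integrableOn_box_of_continuous_real ((((continuous_tp _ _).norm).pow _).mul
        (((continuous_tp _ _).norm).pow _))
    calc ∫ α in box k, (‖GG α‖ * ‖f α‖ ^ m') ^ 2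
        ≤ ∫ α in box k, KD * ∑ g' ∈ Gset C, ‖tp (Xg t B g') (psvR k h g) α‖ ^ 2 * ‖f α‖ ^ (2 * m') := by
          refine integral_mono_of_nonneg (ae_of_all _ fun α => by positivity) ?_ (ae_of_all _ hpt)
          exact (integrable_finsetSum _ fun g' _ => hint2 g').const_mul _
      _ = KD * ∑ g' ∈ Gset C, ∫ α in box k, ‖tp (Xg t B g') (psvR k h g) α‖ ^ 2 * ‖f α‖ ^ (2 * m') := by
          rw [integral_const_mul, integral_finsetSum _ fun g' _ => hint2 g']
      _ ≤ KD * (Gmax * ∫ α in box k, ‖f α‖ ^ (2 * (t + m'))) :=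
          mul_le_mul_of_nonneg_left (sum_integral_Gg_sq_le m' hG0 hGmax) hKD0
      _ ≤ KD * (Gmax * (Jt ^ (1 / ((m' : ℝ) + 1)) * S₀ ^ (1 - 1 / ((m' : ℝ) + 1)))) :=
          mul_le_mul_of_nonneg_left (mul_le_mul_of_nonneg_left (integral_norm_pow_interpolate m') hG0) hKD0
      _ = KD * Gmax * (Jt ^ (1 / ((m' : ℝ) + 1)) * S₀ ^ (1 - 1 / ((m' : ℝ) + 1))) := by ring
  -- Step 4: assemble
  have hN0 : 0 ≤ ∫ α in box k, ‖f α‖ ^ (t + (m' + 1)) * (‖GG α‖ * ‖f α‖ ^ m') :=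
    integral_nonneg fun α => by positivity
  have hI1 : 0 ≤ ∫ α in box k, (‖f α‖ ^ (t + (m' + 1))) ^ 2 := integral_nonneg fun α => by positivity
  have hI2 : 0 ≤ ∫ α in box k, (‖GG α‖ * ‖f α‖ ^ m') ^ 2 := integral_nonneg fun α => by positivity
  have hm1 : 0 ≤ 1 - 1 / ((m' : ℝ) + 1) := by
    rw [sub_nonneg, div_le_one (by positivity)]; linarith [(Nat.cast_nonneg m' : (0 : ℝ) ≤ m')]
  calc ((S3count k h g t m' B C D Pn : ℕ) : ℝ) ^ 2
      ≤ (∫ α in box k, ‖f α‖ ^ (t + (m' + 1)) * (‖GG α‖ * ‖f α‖ ^ m')) ^ 2 :=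
        pow_le_pow_left₀ (Nat.cast_nonneg _) h1' 2
    _ ≤ ((∫ α in box k, (‖f α‖ ^ (t + (m' + 1))) ^ 2) ^ (1 / 2 : ℝ)
          * (∫ α in box k, (‖GG α‖ * ‖f α‖ ^ m') ^ 2) ^ (1 / 2 : ℝ)) ^ 2 :=
        pow_le_pow_left₀ hN0 h2 2
    _ = (∫ α in box k, (‖f α‖ ^ (t + (m' + 1))) ^ 2) * ∫ α in box k, (‖GG α‖ * ‖f α‖ ^ m') ^ 2 := by
        rw [mul_pow, ← Real.rpow_natCast, ← Real.rpow_natCast, ← Real.rpow_mul hI1, ← Real.rpow_mul hI2]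
        norm_num
    _ ≤ S₀ * (KD * Gmax * (Jt ^ (1 / ((m' : ℝ) + 1)) * S₀ ^ (1 - 1 / ((m' : ℝ) + 1)))) := by
        rw [hA]; exact mul_le_mul_of_nonneg_left hB hS₀0
    _ = KD * Gmax * Jt ^ (1 / ((m' : ℝ) + 1)) * S₀ ^ (2 - 1 / ((m' : ℝ) + 1)) := by
        rw [show (2 : ℝ) - 1 / ((m' : ℝ) + 1) = 1 + (1 - 1 / ((m' : ℝ) + 1)) by ring,
          Real.rpow_add_of_nonneg hS₀0 zero_le_one hm1, Real.rpow_one]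
        ring


end FordVK
end Literature.NumberTheory.LFunctions
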